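import Literature.Computability.Cryptography.UnitResidueSteps
import HarnessLib

/-!
# The unit-residue algorithm, II: exact small Bezout pairs and the giant step

Topic `Computability/Cryptography`, continuing `UnitResidueSteps.lean`. The squaring of a frame
(`Infra.sq`, `InfrastructureSquaring.lean`) needs EXACT Bezout pairs `μa' + νb' = 1`, `κg + λc = 1`
whose size is polynomially bounded (the machine clamps its registers). We obtain them from the
modular inverse: `invMod x y` runs the extended Euclidean algorithm keeping only the coefficient of
`y`, reduced modulo `x` at every step (so every intermediate value is below `x`), and returns
`ν₀ = y⁻¹ mod x ∈ [0, x)`; then `μ₀ = (1 - ν₀ y)/x` is an exact integer with `|μ₀| ≤ y`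
(Knuth, TAOCP 2, §4.5.2, Alg. X, and exercise on computing only one cofactor). Results:

* `invStep`, `invMod`; `invMod_spec` — for `x ≥ 1`, `y ≥ 0`, `gcd(x, y) = 1` and fuel
  `≥ 2·size y`, `(invMod x y · y) ≡ 1 (mod x)` and `0 ≤ invMod < x` (the second remainder at
  least halves every two steps, `invStep_two`);
* `bez x y = (μ₀, ν₀)` with `μ₀ x + ν₀ y = 1` (`bez_spec`), `0 ≤ ν₀ < x`, `|μ₀| ≤ y + 1`;
* `sqF` — the giant step with float bookkeeping: new frame `Infra.sq` with the pairs `bez a' b'`,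
  `bez g c`; float `F² · (1/g)`; sign `+`. **`Good.sqF`**: from a good (reduced) state with accuracy
  `ε` we get a state satisfying the frame invariant with `θ' = θ²/g > 0`, accuracy `2ε + 6/2^P`, and
  new norm `a' < Δ` (Jacobson–Williams §12.2, the squaring inside Alg. 12.6 CR; §5.4).

Everything is proved; no named facts.

## References

* M. J. Jacobson, Jr., H. C. Williams, *Solving the Pell Equation*, CMS Books in Mathematics, Springer
  (2009), §5.4 (ideal products), §12.2 (Alg. 12.6 CR). [JacobsonWilliams2008]
* D. E. Knuth, *The Art of Computer Programming*, Vol. 2, 3rd ed. (1998), §4.5.2 (Alg. X; the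
  number of division steps). [KnuthTAOCP2]
-/

noncomputable section

open scoped Classical

namespace Literature.Computability.Cryptography.UnitResidue

open Literature.NumberTheory.QuadraticFields.Infra

/-! ### The modular inverse by the half extended Euclidean algorithm -/

/-- One step of the half extended Euclidean algorithm modulo `x`: `(r₀, r₁, t₀, t₁) ↦
(r₁, r₀ mod r₁, t₁, (t₀ - ⌊r₀/r₁⌋ t₁) mod x)`, fixed once `r₁ = 0`. [cite: KnuthTAOCP2, §4.5.2 Alg. X] -/
def invStep (x : ℤ) (st : ℤ × ℤ × ℤ × ℤ) : ℤ × ℤ × ℤ × ℤ :=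
  if st.2.1 = 0 then st
  else (st.2.1, st.1 % st.2.1, st.2.2.2, (st.2.2.1 - st.1 / st.2.1 * st.2.2.2) % x)

/-- **The modular inverse** `y⁻¹ mod x` (when `gcd(x, y) = 1`): the `t₀`-component after `fuel`
steps from `(x, y, 0, 1 mod x)`. [cite: KnuthTAOCP2, §4.5.2 Alg. X] -/
def invMod (x y : ℤ) (fuel : ℕ) : ℤ := ((invStep x)^[fuel] (x, y, 0, 1 % x)).2.2.1

/-- The Bezout-type invariant of the loop: the remainders are combinations `S x + T y` with the
stored `t`'s congruent to the `T`'s modulo `x`, remainders nonnegative. [cite: KnuthTAOCP2, §4.5.2 (4)] -/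
def InvInv (x y : ℤ) (st : ℤ × ℤ × ℤ × ℤ) : Prop :=
  ∃ S₀ T₀ S₁ T₁ : ℤ, st.1 = S₀ * x + T₀ * y ∧ st.2.1 = S₁ * x + T₁ * y ∧
    st.2.2.1 = T₀ % x ∧ st.2.2.2 = T₁ % x ∧ 0 ≤ st.1 ∧ 0 ≤ st.2.1 ∧
    Int.gcd st.1 st.2.1 = Int.gcd x y

/-- The invariant holds initially. [folklore] -/
theorem invInv_init {x y : ℤ} (hx : 1 ≤ x) (hy : 0 ≤ y) : InvInv x y (x, y, 0, 1 % x) :=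
  ⟨1, 0, 0, 1, by ring, by ring, by simp, rfl, by simp; omega, hy, rfl⟩

/-- The invariant is preserved by a step. [cite: KnuthTAOCP2, §4.5.2 Alg. X] -/
theorem InvInv.step {x y : ℤ} {st : ℤ × ℤ × ℤ × ℤ} (h : InvInv x y st) :
    InvInv x y (invStep x st) := by
  obtain ⟨S₀, T₀, S₁, T₁, h0, h1, ht0, ht1, hr0, hr1, hg⟩ := h
  unfold invStep
  split_ifs with hz
  · exact ⟨S₀, T₀, S₁, T₁, h0, h1, ht0, ht1, hr0, hr1, hg⟩
  · refine ⟨S₁, T₁, S₀ - st.1 / st.2.1 * S₁, T₀ - st.1 / st.2.1 * T₁, h1, ?_, ht1, ?_, hr1,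
      Int.emod_nonneg _ hz, ?_⟩
    · show st.1 % st.2.1 = (S₀ - st.1 / st.2.1 * S₁) * x + (T₀ - st.1 / st.2.1 * T₁) * y
      rw [Int.emod_def]
      linear_combination h0 - (st.1 / st.2.1) * h1
    · show (st.2.2.1 - st.1 / st.2.1 * st.2.2.2) % x = (T₀ - st.1 / st.2.1 * T₁) % x
      rw [ht0, ht1]
      exact ((Int.mod_modEq T₀ x).sub ((Int.mod_modEq T₁ x).mul_left _))
    · show Int.gcd st.2.1 (st.1 % st.2.1) = Int.gcd x y
      rw [← hg, Int.gcd_comm st.1, Int.emod_def, show st.1 - st.2.1 * (st.1 / st.2.1) =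
        st.1 + (-(st.1 / st.2.1)) * st.2.1 by ring, Int.gcd_add_mul_right_right]

/-- The invariant after any number of steps. [folklore] -/
theorem invInv_iterate {x y : ℤ} (hx : 1 ≤ x) (hy : 0 ≤ y) (k : ℕ) :
    InvInv x y ((invStep x)^[k] (x, y, 0, 1 % x)) := by
  induction k with
  | zero => exact invInv_init hx hy
  | succ k ih => rw [Function.iterate_succ_apply']; exact ih.step

/-- **Two steps at least halve the second remainder** (`r mod r' < r/2` when `r' ≤ r`).
[cite: KnuthTAOCP2, §4.5.3 (Cor. L, the number of division steps)] -/
theorem invStep_two {x : ℤ} (st : ℤ × ℤ × ℤ × ℤ) (h0 : 0 ≤ st.1) (h1 : 0 ≤ st.2.1) :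
    2 * (invStep x (invStep x st)).2.1 ≤ st.2.1 ∧ 0 ≤ (invStep x (invStep x st)).2.1 ∧
      0 ≤ (invStep x (invStep x st)).1 := by
  unfold invStep
  by_cases hz : st.2.1 = 0
  · simp only [hz, if_true]
    exact ⟨by norm_num, le_refl _, h0⟩
  · rw [if_neg hz]
    simp only
    have hb : 0 < st.2.1 := lt_of_le_of_ne h1 (Ne.symm hz)
    set c := st.1 % st.2.1 with hc
    have hc0 : 0 ≤ c := Int.emod_nonneg _ hz
    have hcb : c < st.2.1 := Int.emod_lt_of_pos _ hb
    by_cases hcz : c = 0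
    · rw [if_pos hcz]; simp only; omega
    · rw [if_neg hcz]
      simp only
      have hcpos : 0 < c := lt_of_le_of_ne hc0 (Ne.symm hcz)
      have hm0 : 0 ≤ st.2.1 % c := Int.emod_nonneg _ hcz
      have hm1 : st.2.1 % c < c := Int.emod_lt_of_pos _ hcpos
      -- `b mod c ≤ b - c` since `c ≤ b` and `b / c ≥ 1`
      have hq : 1 ≤ st.2.1 / c := by
        rw [Int.le_ediv_iff_mul_le hcpos]; linarith
      have hm2 : st.2.1 % c ≤ st.2.1 - c := by
        rw [Int.emod_def]; nlinarith
      omega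

/-- After `2k` steps the second remainder is at most `y / 2^k`. [cite: KnuthTAOCP2, §4.5.3 Cor. L] -/
theorem invStep_iterate_le {x y : ℤ} (hx : 0 ≤ x) (hy : 0 ≤ y) (k : ℕ) :
    ((invStep x)^[2 * k] (x, y, 0, 1 % x)).2.1 * 2 ^ k ≤ y ∧ 0 ≤ ((invStep x)^[2 * k] (x, y, 0, 1 % x)).2.1 ∧
      0 ≤ ((invStep x)^[2 * k] (x, y, 0, 1 % x)).1 := by
  induction k with
  | zero => simp [hy, hx]
  | succ k ih =>
    obtain ⟨ih1, ih2, ih3⟩ := ih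
    rw [show 2 * (k + 1) = (2 * k + 1) + 1 by ring, Function.iterate_succ_apply', Function.iterate_succ_apply']
    obtain ⟨h1, h2, h3⟩ := invStep_two (x := x) ((invStep x)^[2 * k] (x, y, 0, 1 % x)) ih3 ih2
    refine ⟨?_, h2, h3⟩
    rw [pow_succ]
    have := mul_le_mul_of_nonneg_right h1 (pow_nonneg (by norm_num : (0:ℤ) ≤ 2) k)
    nlinarith

/-- Once the second remainder vanishes the state is fixed. [folklore] -/
theorem invStep_fixed {x : ℤ} {st : ℤ × ℤ × ℤ × ℤ} (h : st.2.1 = 0) (k : ℕ) : (invStep x)^[k] st = st := by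
  induction k with
  | zero => rfl
  | succ k ih => rw [Function.iterate_succ_apply', ih]; unfold invStep; rw [if_pos h]

/-- **Specification of the modular inverse**: for `x ≥ 1`, `y ≥ 0` coprime and fuel
`≥ 2 · size y + 2`, `invMod x y · y ≡ 1 (mod x)` and `0 ≤ invMod x y < x` (for `x = 1` the value is `0`).
[cite: KnuthTAOCP2, §4.5.2 Alg. X] -/
theorem invMod_spec {x y : ℤ} (hx : 1 ≤ x) (hy : 0 ≤ y) (hg : Int.gcd x y = 1) {fuel : ℕ}
    (hfuel : 2 * isize y + 2 ≤ fuel) :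
    (invMod x y fuel * y) % x = 1 % x ∧ 0 ≤ invMod x y fuel ∧ invMod x y fuel < x := by
  -- after `2 (size y + 1)` steps the second remainder is `0`
  set k := isize y + 1 with hk
  obtain ⟨h1, h2, _⟩ := invStep_iterate_le (x := x) (by omega) hy k
  have hzero : ((invStep x)^[2 * k] (x, y, 0, 1 % x)).2.1 = 0 := by
    have hlt := lt_two_pow_isize hy
    by_contra hne
    have hpos : 1 ≤ ((invStep x)^[2 * k] (x, y, 0, 1 % x)).2.1 := by omega
    have : (2 : ℤ) ^ k ≤ y := by nlinarith [pow_pos (show (0:ℤ) < 2 by norm_num) k]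
    rw [hk, pow_succ] at this
    nlinarith [pow_pos (show (0:ℤ) < 2 by norm_num) (isize y)]
  have hfix : (invStep x)^[fuel] (x, y, 0, 1 % x) = (invStep x)^[2 * k] (x, y, 0, 1 % x) := by
    have : fuel = (fuel - 2 * k) + 2 * k := by omega
    rw [this, Function.iterate_add_apply, invStep_fixed hzero]
  obtain ⟨S₀, T₀, S₁, T₁, e0, e1, et0, _, _, _, hgcd⟩ := invInv_iterate hx hy (2 * k)
  unfold invMod
  rw [hfix, et0]
  rw [hzero] at hgcd e1
  -- `r₀ = gcd = 1`
  have hr0 : ((invStep x)^[2 * k] (x, y, 0, 1 % x)).1 = 1 := by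
    have := Int.gcd_zero_right ((invStep x)^[2 * k] (x, y, 0, 1 % x)).1
    rw [hgcd, hg] at this
    have h0 : 0 ≤ ((invStep x)^[2 * k] (x, y, 0, 1 % x)).1 := by
      obtain ⟨_, _, h3⟩ := invStep_iterate_le (x := x) (by omega) hy k; exact h3
    omega
  rw [hr0] at e0
  refine ⟨?_, Int.emod_nonneg _ (by omega), Int.emod_lt_of_pos _ (by omega)⟩
  -- `T₀ y ≡ 1 (mod x)`
  have : (T₀ % x * y) % x = (T₀ * y) % x := by rw [Int.mul_emod, Int.emod_emod_of_dvd _ (dvd_refl x), ← Int.mul_emod]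
  rw [this, show T₀ * y = 1 + (-S₀) * x by linarith, Int.add_mul_emod_self_right]

/-! ### Exact small Bezout pairs -/

/-- **The small Bezout pair** `(μ₀, ν₀)` with `ν₀ = y⁻¹ mod x`, `μ₀ = (1 - ν₀ y)/x`.
[cite: KnuthTAOCP2, §4.5.2 (exercise: recovering the second cofactor)] -/
def bez (x y : ℤ) (fuel : ℕ) : ℤ × ℤ := ((1 - invMod x y fuel * y) / x, invMod x y fuel)

/-- **`μ₀ x + ν₀ y = 1` exactly**, with `0 ≤ ν₀ < x` and `|μ₀| ≤ y + 1`. [cite: KnuthTAOCP2, §4.5.2] -/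
theorem bez_spec {x y : ℤ} (hx : 1 ≤ x) (hy : 0 ≤ y) (hg : Int.gcd x y = 1) {fuel : ℕ}
    (hfuel : 2 * isize y + 2 ≤ fuel) :
    (bez x y fuel).1 * x + (bez x y fuel).2 * y = 1 ∧ 0 ≤ (bez x y fuel).2 ∧ (bez x y fuel).2 < x ∧
      |(bez x y fuel).1| ≤ y + 1 := by
  obtain ⟨hmod, h0, hlt⟩ := invMod_spec hx hy hg hfuel
  set ν := invMod x y fuel
  have hdvd : x ∣ 1 - ν * y := by
    rw [Int.dvd_iff_emod_eq_zero, Int.sub_emod, ← hmod, Int.sub_self, Int.zero_emod]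
  have hμ : (1 - ν * y) / x * x = 1 - ν * y := Int.ediv_mul_cancel hdvd
  unfold bez
  refine ⟨by linarith, h0, hlt, ?_⟩
  -- `|μ₀| x = |1 - ν y| ≤ 1 + ν y < 1 + x y ≤ x (y + 1)`… divide by `x ≥ 1`
  have habs : |(1 - ν * y) / x| * x ≤ (y + 1) * x := by
    rw [← abs_of_pos (by omega : (0:ℤ) < x), ← abs_mul, abs_of_pos (by omega : (0:ℤ) < x), hμ]
    rw [abs_le]; constructor <;> nlinarith
  exact le_of_mul_le_mul_right habs (by omega)

/-! ### The giant step -/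

/-- The Bezout data of a frame: `(μ₀, ν₀)` for `(a', b')` and `(κ₀, λ₀)` for `(g, c)`.
[cite: JacobsonWilliams2008, §5.4] -/
def sqData (pm : Prm) (S : St) (fuel : ℕ) : (ℤ × ℤ) × (ℤ × ℤ) :=
  (bez S.a1 S.b1 fuel, bez S.g (S.c pm.Δ) fuel)

/-- **The giant step with bookkeeping**: square the frame with the exact small Bezout pairs, square
the float and multiply by `1/g`, reset the sign to `+` (`θ' = θ²/g > 0`).
[cite: JacobsonWilliams2008, §12.2 (Alg. 12.6 CR, squaring step), §5.4] -/
def sqF (pm : Prm) (fuel : ℕ) (s : AS) : AS :=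
  let D := sqData pm s.fr fuel
  let F1 := mulF pm.P s.M s.E s.M s.E
  let fg := floatOf pm.P 1 s.fr.g
  let F2 := mulF pm.P F1.1 F1.2 fg.1 fg.2
  ⟨sq pm.Δ s.fr D.1.1 D.1.2 D.2.1 D.2.2, 1, F2.1, F2.2⟩

variable {pm : Prm}

/-- In a reduced frame `a' ≥ 1`, `b' ≥ 1`, `gcd(a', b') = 1`, and `g ≥ 1`, `c ≥ 1`, `gcd(g, c) = 1`
(fundamental discriminant). [cite: JacobsonWilliams2008, §5.4] -/
theorem Prm.OK.bezout_hyps (h : pm.OK) {S : St} (hI : Inv pm.Δ S) (hR : Red pm.Δ S) :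
    1 ≤ S.a1 ∧ 0 ≤ S.b1 ∧ Int.gcd S.a1 S.b1 = 1 ∧ 1 ≤ S.g ∧ 0 ≤ S.c pm.Δ ∧ Int.gcd S.g (S.c pm.Δ) = 1 := by
  have hg := hI.g_pos
  have hb := hR.b_pos
  have hc := hI.c_pos hR
  refine ⟨hI.a1_pos, ?_, ?_, hg, by omega, ?_⟩
  · have := hI.b_eq; nlinarith
  · unfold St.a1 St.b1 St.g
    exact Int.gcd_div_gcd_div_gcd (Int.gcd_pos_of_ne_zero_left _ (by have := hI.1; omega))
  · have := hI.gcd_gcd_c h.fund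
    unfold St.g
    exact this

/-- Sizes in a reduced frame: `b' ≤ Δ` and `c ≤ Δ`. [folklore] -/
theorem bezout_sizes {S : St} (hI : Inv pm.Δ S) (hR : Red pm.Δ S) :
    S.b1 ≤ pm.Δ ∧ S.c pm.Δ ≤ pm.Δ := by
  have hb := hR.b_pos
  have hb2 := hR.b_sq_lt
  have hg := hI.g_pos
  have hbe := hI.b_eq
  have hac := hI.four_a_c
  have ha : (1:ℤ) ≤ S.a := by exact_mod_cast hI.1
  constructor
  · nlinarith
  · nlinarith

/-- **The giant step**: from a good (reduced) state with accuracy `ε` and enough fuel, the squared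
state satisfies the frame invariant, `θ' = θ²/g > 0` (sign `+`), the float has accuracy
`2ε + 6/2^P`, and the new norm is `< Δ`. [cite: JacobsonWilliams2008, §12.2 (Alg. 12.6), §5.4] -/
theorem Good.sqF_spec (h : pm.OK) {s : AS} {ε : ℝ} (hg : Good pm s ε) {fuel : ℕ}
    (hfuel : 2 * Nat.size pm.Δ + 2 ≤ fuel) :
    GoodI pm (sqF pm fuel s) (2 * ε + 6 / (2 : ℝ) ^ pm.P) ∧
      (s.fr.g : ℝ) * ev pm.Δ (rt pm.Δ) (UnitResidue.sqF pm fuel s).fr.p = ev pm.Δ (rt pm.Δ) s.fr.p ^ 2 ∧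
      ((UnitResidue.sqF pm fuel s).fr.a : ℤ) < pm.Δ := by
  have hI := hg.inv
  have hR := hg.red
  obtain ⟨ha1, hb1, hgab, hg1, hc0, hggc⟩ := h.bezout_hyps hI hR
  obtain ⟨hbΔ, hcΔ⟩ := bezout_sizes hI hR
  -- fuel suffices for both inverses
  have hszΔ : ∀ z : ℤ, 0 ≤ z → z ≤ pm.Δ → 2 * isize z + 2 ≤ fuel := by
    intro z hz0 hz
    have : isize z ≤ Nat.size pm.Δ := by
      unfold isize
      apply Nat.size_le_size
      have : z.toNat ≤ pm.Δ := by omega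
      exact this
    omega
  obtain ⟨hmn, _, _, _⟩ := bez_spec ha1 hb1 hgab (hszΔ _ hb1 hbΔ)
  obtain ⟨hkl, _, _, _⟩ := bez_spec hg1 hc0 hggc (hszΔ _ hc0 hcΔ)
  have hmn' : (bez s.fr.a1 s.fr.b1 fuel).1 * s.fr.a1 + (bez s.fr.a1 s.fr.b1 fuel).2 * s.fr.b1 = 1 := hmn
  have hkl' : (bez s.fr.g (s.fr.c pm.Δ) fuel).1 * s.fr.g + (bez s.fr.g (s.fr.c pm.Δ) fuel).2 * s.fr.c pm.Δ = 1 := hkl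
  have hInv := hI.sq h.disc hmn' hkl'
  have hev := hI.ev_sq_p h.disc (μ := (bez s.fr.a1 s.fr.b1 fuel).1) (ν := (bez s.fr.a1 s.fr.b1 fuel).2) hkl' (rt_sq _)
  have hAlt := hI.sq_a_lt hR (bez s.fr.a1 s.fr.b1 fuel).1 (bez s.fr.a1 s.fr.b1 fuel).2
    (bez s.fr.g (s.fr.c pm.Δ) fuel).1 (bez s.fr.g (s.fr.c pm.Δ) fuel).2
  -- the float: `F² · (1/g)`
  have hθ0 : ev pm.Δ (rt pm.Δ) s.fr.p ≠ 0 := hI.ev_p_ne_zero h.disc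
  have hgR : (1 : ℝ) ≤ s.fr.g := by exact_mod_cast hg1
  have hacc1 := hg.acc.mulF hg.acc
  have hacc_g : Acc pm.P (floatOf pm.P 1 s.fr.g).1 (floatOf pm.P 1 s.fr.g).2 ((1 : ℤ) / (s.fr.g : ℤ) : ℝ) (2 / (2 : ℝ) ^ pm.P) := by
    have := acc_floatOf (P := pm.P) (u := 1) (v := s.fr.g) le_rfl hg1 (by unfold isize; simp; omega)
    push_cast at this ⊢
    exact this
  have hacc2 := hacc1.mulF hacc_g
  have htarget : |ev pm.Δ (rt pm.Δ) s.fr.p| * |ev pm.Δ (rt pm.Δ) s.fr.p| * ((1 : ℤ) / (s.fr.g : ℤ) : ℝ) =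
      |ev pm.Δ (rt pm.Δ) (UnitResidue.sqF pm fuel s).fr.p| := by
    have e : ev pm.Δ (rt pm.Δ) (UnitResidue.sqF pm fuel s).fr.p = ev pm.Δ (rt pm.Δ) s.fr.p ^ 2 / s.fr.g := by
      rw [eq_div_iff (by positivity), mul_comm]; exact hev
    rw [e, abs_div, abs_of_pos (by positivity : (0:ℝ) < s.fr.g), abs_pow, pow_two]
    push_cast
    field_simp
  refine ⟨⟨hInv, Or.inl rfl, ?_, ?_⟩, hev, ?_⟩
  · show (0 : ℝ) < ((1 : ℤ) : ℝ) * ev pm.Δ (rt pm.Δ) (UnitResidue.sqF pm fuel s).fr.p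
    push_cast; rw [one_mul]
    have e : ev pm.Δ (rt pm.Δ) (UnitResidue.sqF pm fuel s).fr.p = ev pm.Δ (rt pm.Δ) s.fr.p ^ 2 / s.fr.g := by
      rw [eq_div_iff (by positivity), mul_comm]; exact hev
    rw [e]; positivity
  · show Acc pm.P _ _ |ev pm.Δ (rt pm.Δ) (UnitResidue.sqF pm fuel s).fr.p| _
    rw [← htarget]
    refine hacc2.mono (le_of_eq ?_)
    ring
  · exact_mod_cast (show ((UnitResidue.sqF pm fuel s).fr.a : ℝ) < pm.Δ from hAlt)

end Literature.Computability.Cryptography.UnitResidue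

end
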